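import Summits.Ventures.PercRepro.SixFourResidueFourGenericHolds
import Summits.Ventures.PercRepro.SixFourResidueTypeThreeSmallHolds

/-!
# PercRepro — C-025 at `(6,4)`: the residue in THREE pieces (p3, gen 11)

With `typeThreeSmall_holds` (`SixFourResidueTypeThreeSmallHolds.lean`) and `genericFourBig_holds`
(`SixFourResidueFourGenericHolds.lean`, Theorem G at `t = 4` with no plane cap) two of the five named `Prop`s of the
residue of record are discharged, and `SixFourResidue` — hence C-025 at `(6,4)` on every finite matroid — reduces to
**`TwentyOnePrime ∧ PlaneAddTwoFour ∧ PlaneLineFourBig`** (`sixFourResidue_of_three_pieces`, `rls_six_four_of_three_pieces`).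
-/

namespace PercRepro.SixFour

open Finset ThmH PerFlat ThmN

/-- **`SixFourResidue` from the three remaining pieces of record**: Theorem 21′ (`t = 3`, `g ≥ 10`), Theorem 21.6 at
`t = 4` for every size, and the plane-line branch at `t = 4` with a plane trace of `≥ 8` points. -/
theorem sixFourResidue_of_three_pieces (h3b : TwentyOnePrime) (hβ : PlaneAddTwoFour) (hγ : PlaneLineFourBig) :
    SixFourResidue :=
  sixFourResidue_of_four_pieces typeThreeSmall_holds h3b hβ hγ

/-- **C-025 at `(6, 4)` on every finite matroid from the three remaining pieces of record**: `RLS M 6 4`. -/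
theorem rls_six_four_of_three_pieces {α : Type} (h3b : TwentyOnePrime) (hβ : PlaneAddTwoFour) (hγ : PlaneLineFourBig)
    (M : Matroid α) [M.Finite] : RLS M 6 4 :=
  rls_six_four_of_residue (sixFourResidue_of_three_pieces h3b hβ hγ) M

end PercRepro.SixFour
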